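import Summits.KontsevichZagierPeriods.KontsevichZagierPeriods.Theorems.LinRedNormalFormArrangementNormalFormStubRebaseSimplePosOneFibreCornerBlow

/-!
# Stub `stub_rebaseSimplePosOneZero` (crux `ArrangementNormalForm`, line `janus-bands`) —
part `CornerSteep`: the blow-up of a corner, steep chart

Corner toolkit for the double-corner bands at `B = 1`, third file. The companion of
`RebasePos.cornerBlowUp` for the STEEP sector piece `{rows, 0 < x < y < ε}` of a corner at the
origin (base pole `y = 0`, letter `0`, bounds through the origin): the rational blow-up
`x = ρ`, `y = ρ/ξ`, `t = ρ θ/ξ` (rule 2, Jacobian `ρ²/ξ³`; `ξ = x/y ∈ (0, 1)`) moves it to the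
literal datum `[{rows', ρ > 0, 0 < ξ < 1, ρ < ε ξ, U(ξ) < θ < V(ξ)}, R(ρ)/ξ · 1/θ]` with the
SAME literal integrand text and `ρ`-free bounds `U = u/y`, `V = v/y` read as forms in `ξ`
(`RebasePos.cornerBlowUpSteep`). The radial variable is `x` itself in both charts, which keeps
the silent factor `R(x)` literal.

References: M. Kontsevich, D. Zagier, *Periods* (2001), §1.2, rule (2).
-/

noncomputable section

open Set MeasureTheory MvPolynomial
open Literature.NumberTheory.Transcendental Literature.ModelTheory.ExponentialFields

namespace Summit.KontsevichZagierPeriods.ArrangementNormalForm.JanusBands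

namespace RebasePos

open SeparatePos

section SteepData

/-- The steep blow-up `(ρ, ξ, θ) ↦ (ρ, ρ/ξ, ρ θ/ξ)`. -/
def blowU (w : Fin (1 + 1 + 1) → ℝ) : Fin (1 + 1 + 1) → ℝ := ![w 0, w 0 / w 1, w 0 * w 2 / w 1]

/-- Its inverse `(x, y, t) ↦ (x, x/y, t/y)`. -/
def blowUInv (z : Fin (1 + 1 + 1) → ℝ) : Fin (1 + 1 + 1) → ℝ := ![z 0, z 0 / z 1, z 2 / z 1]

/-- The Jacobian matrix of `blowU`. -/
def blowUMat (w : Fin (1 + 1 + 1) → ℝ) : Matrix (Fin (1 + 1 + 1)) (Fin (1 + 1 + 1)) ℝ :=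
  !![1, 0, 0; (w 1)⁻¹, -(w 0 / w 1 ^ 2), 0; w 2 / w 1, -(w 0 * w 2 / w 1 ^ 2), w 0 / w 1]

/-- The derivative of `blowU`. -/
def blowULin (w : Fin (1 + 1 + 1) → ℝ) : (Fin (1 + 1 + 1) → ℝ) →L[ℝ] (Fin (1 + 1 + 1) → ℝ) :=
  LinearMap.toContinuousLinearMap (Matrix.toLin' (blowUMat w))

/-- A row through the origin, read in the steep chart: `c_x x + c_y y = (ρ/ξ)(c_x ξ + c_y)`;
`y`-free rows are kept. -/
def chartRowU (c : (Fin (1 + 1) → ℚ) × ℚ) : (Fin (1 + 1) → ℚ) × ℚ :=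
  if c.1 1 = 0 then c else (![0, c.1 0], c.1 1)

/-- A bound through the origin, read in the steep chart: `u = (ρ/ξ) U(ξ)`, `U = u_x ξ + u_y`. -/
def chartFU (c : (Fin (1 + 1) → ℚ) × ℚ) : (Fin (1 + 1) → ℚ) × ℚ := (![0, c.1 0], c.1 1)

/-- The four rows of the steep sector piece: `x > 0`, `y > 0`, `y − x > 0`, `ε − y > 0`. -/
def boxRowsU (ε : ℚ) : Fin 4 → (Fin (1 + 1) → ℚ) × ℚ :=
  ![(![1, 0], 0), (![0, 1], 0), (![-1, 1], 0), (![0, -1], ε)]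

/-- Their chart images: `ρ > 0`, `ξ > 0`, `1 − ξ > 0`, `ε ξ − ρ > 0`. -/
def outRowsU (ε : ℚ) : Fin 4 → (Fin (1 + 1) → ℚ) × ℚ :=
  ![(![1, 0], 0), (![0, 1], 0), (![0, -1], 1), (![-1, ε], 0)]

/-- `blowU` on the `x`-slot. -/
@[simp] theorem blowU_zero (w : Fin (1 + 1 + 1) → ℝ) : blowU w 0 = w 0 := rfl

/-- `blowU` on the `y`-slot. -/
@[simp] theorem blowU_one (w : Fin (1 + 1 + 1) → ℝ) : blowU w 1 = w 0 / w 1 := rfl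

/-- `blowU` on the `t`-slot. -/
@[simp] theorem blowU_two (w : Fin (1 + 1 + 1) → ℝ) : blowU w 2 = w 0 * w 2 / w 1 := rfl

/-- Silent forms are unchanged by `blowU`. -/
@[simp] theorem affB_blowU (d : (Fin 1 → ℚ) × ℚ) (w : Fin (1 + 1 + 1) → ℝ) :
    affB 1 1 d (blowU w) = affB 1 1 d w := by
  rw [affB_two, affB_two, blowU_zero]

/-- Rows through the origin or `y`-free, read in the steep chart (for `ρ, ξ > 0`). -/
theorem affF_blowU_pos_iff (c : (Fin (1 + 1) → ℚ) × ℚ) (hc : c.1 1 ≠ 0 → c.2 = 0)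
    (w : Fin (1 + 1 + 1) → ℝ) (hρ : 0 < w 0) (hξ : 0 < w 1) :
    0 < affF 1 1 c (blowU w) ↔ 0 < affF 1 1 (chartRowU c) w := by
  by_cases h : c.1 1 = 0
  · rw [chartRowU, if_pos h, affF_two, affF_two, h]
    simp
  · have h2 : c.2 = 0 := hc h
    rw [chartRowU, if_neg h, affF_two, affF_two, h2]
    simp only [blowU_zero, blowU_one, Rat.cast_zero, add_zero, Matrix.cons_val_zero, zero_mul,
      Matrix.cons_val_one, zero_add]
    have hq : 0 < w 0 / w 1 := div_pos hρ hξ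
    rw [show (c.1 0 : ℝ) * w 0 + (c.1 1 : ℝ) * (w 0 / w 1) = (w 0 / w 1) * ((c.1 0 : ℝ) * w 1 + c.1 1) by
      field_simp]
    exact ⟨fun h' => pos_of_mul_pos_right h' hq.le, fun h' => mul_pos hq h'⟩

/-- Bounds through the origin, read in the steep chart. -/
theorem affF_blowU_eq (c : (Fin (1 + 1) → ℚ) × ℚ) (hc : c.2 = 0) (w : Fin (1 + 1 + 1) → ℝ)
    (hξ : w 1 ≠ 0) : affF 1 1 c (blowU w) = w 0 / w 1 * affF 1 1 (chartFU c) w := by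
  rw [affF_two, affF_two, chartFU, hc]
  simp only [blowU_zero, blowU_one, Rat.cast_zero, add_zero, Matrix.cons_val_zero, zero_mul,
    Matrix.cons_val_one, zero_add]
  field_simp

/-- The four sector rows, read in the steep chart. -/
theorem boxRowsU_iff (ε : ℚ) (w : Fin (1 + 1 + 1) → ℝ) :
    (∀ k, 0 < affF 1 1 (boxRowsU ε k) (blowU w)) ↔ (∀ k, 0 < affF 1 1 (outRowsU ε k) w) := by
  simp only [Fin.forall_fin_succ, IsEmpty.forall_iff, and_true]
  simp [boxRowsU, outRowsU, affF_two]
  intro h0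
  constructor
  · rintro ⟨h1, h2, h3⟩
    have hξ : 0 < w 1 := by
      rcases (div_pos_iff.1 h1) with h | h
      · exact h.2
      · exact absurd h.1 (not_lt.2 h0.le)
    refine ⟨hξ, ?_, ?_⟩
    · have : w 0 < w 0 / w 1 := by linarith
      rw [lt_div_iff₀ hξ] at this
      nlinarith
    · rw [div_lt_iff₀ hξ] at h3
      linarith
  · rintro ⟨h1, h2, h3⟩
    refine ⟨div_pos h0 h1, ?_, ?_⟩
    · have : w 0 < w 0 / w 1 := by
        rw [lt_div_iff₀ h1]
        nlinarith
      linarith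
    · rw [div_lt_iff₀ h1]
      linarith

end SteepData

section SteepCalc

/-- `blowULin` in coordinates. -/
theorem blowULin_apply (w v : Fin (1 + 1 + 1) → ℝ) :
    blowULin w v = ![v 0, (w 1)⁻¹ * v 0 - w 0 / w 1 ^ 2 * v 1,
      w 2 / w 1 * v 0 - w 0 * w 2 / w 1 ^ 2 * v 1 + w 0 / w 1 * v 2] := by
  rw [blowULin, LinearMap.coe_toContinuousLinearMap', Matrix.toLin'_apply]
  funext l
  fin_cases l <;> simp [blowUMat, Matrix.mulVec, dotProduct, Fin.sum_univ_three] <;> ring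

/-- The Jacobian determinant of `blowU` is `−ρ²/ξ³`. -/
theorem blowULin_det (w : Fin (1 + 1 + 1) → ℝ) : (blowULin w).det = -(w 0 * w 0 / w 1 ^ 3) := by
  rw [blowULin, ContinuousLinearMap.det, LinearMap.coe_toContinuousLinearMap, LinearMap.det_toLin',
    blowUMat, Matrix.det_fin_three]
  simp
  ring

/-- `blowU` has derivative `blowULin` off `ξ = 0`. -/
theorem hasFDerivAt_blowU (w : Fin (1 + 1 + 1) → ℝ) (hw : w 1 ≠ 0) : HasFDerivAt blowU (blowULin w) w := by
  have h0 := hasFDerivAt_apply (𝕜 := ℝ) (0 : Fin (1 + 1 + 1)) w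
  have h1 := hasFDerivAt_apply (𝕜 := ℝ) (1 : Fin (1 + 1 + 1)) w
  have h2 := hasFDerivAt_apply (𝕜 := ℝ) (2 : Fin (1 + 1 + 1)) w
  have hi := (hasFDerivAt_inv hw).comp w h1
  refine hasFDerivAt_pi'' fun l => ?_
  fin_cases l
  · refine (h0.congr_fderiv ?_).congr_of_eventuallyEq (Filter.Eventually.of_forall fun x => rfl)
    ext v
    simp [blowULin_apply]
  · refine ((h0.mul hi).congr_fderiv ?_).congr_of_eventuallyEq
      (Filter.Eventually.of_forall fun x => by simp [blowU, div_eq_mul_inv])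
    ext v
    simp [blowULin_apply]
    field_simp
    ring
  · refine (((h0.mul h2).mul hi).congr_fderiv ?_).congr_of_eventuallyEq
      (Filter.Eventually.of_forall fun x => by simp [blowU, div_eq_mul_inv])
    ext v
    simp [blowULin_apply]
    field_simp
    ring

/-- `blowU ∘ blowUInv = id` off `x y = 0`. -/
theorem blowU_blowUInv (z : Fin (1 + 1 + 1) → ℝ) (hz : z 0 ≠ 0) (hz' : z 1 ≠ 0) :
    blowU (blowUInv z) = z := by
  funext l
  fin_cases l
  · rfl
  · simp only [blowU, blowUInv, Fin.mk_one, Matrix.cons_val_one, Matrix.cons_val_zero, Matrix.cons_val]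
    field_simp
  · simp only [blowU, blowUInv, Fin.reduceFinMk, Matrix.cons_val, Matrix.cons_val_zero]
    field_simp

/-- `blowUInv ∘ blowU = id` off `ρ ξ = 0`. -/
theorem blowUInv_blowU (w : Fin (1 + 1 + 1) → ℝ) (hw : w 0 ≠ 0) (hw' : w 1 ≠ 0) :
    blowUInv (blowU w) = w := by
  funext l
  fin_cases l
  · rfl
  · simp only [blowU, blowUInv, Fin.mk_one, Matrix.cons_val_one, Matrix.cons_val_zero, Matrix.cons_val]
    field_simp
  · simp only [blowU, blowUInv, Fin.reduceFinMk, Matrix.cons_val, Matrix.cons_val_zero]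
    field_simp

/-- `blowU` is a semialgebraic map (a rational map) on every semialgebraic set. -/
theorem isSemialgebraicMapOn_blowU {R : Set (Fin (1 + 1 + 1) → ℝ)} (hR : IsSemialgebraic ℚ R) :
    IsSemialgebraicMapOn ℚ R blowU := by
  refine IsSemialgebraicMapOn.of_forall hR fun j => ?_
  fin_cases j
  · exact (isSemialgebraicFunOn_aeval hR (X 0)).congr fun w _ => by simp [blowU]
  · exact (IntegrateOut.isSemialgebraicFunOn_div (isSemialgebraicFunOn_aeval hR (X 0))
      (isSemialgebraicFunOn_aeval hR (X 1))).congr fun w _ => by simp [blowU]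
  · exact (IntegrateOut.isSemialgebraicFunOn_div (isSemialgebraicFunOn_aeval hR (X 0 * X 2))
      (isSemialgebraicFunOn_aeval hR (X 1))).congr fun w _ => by simp [blowU]

end SteepCalc

section SteepMove

variable {m m' : ℕ}

/-- The chart rows give `ρ > 0`, `0 < ξ < 1`, `ρ < ε ξ`. -/
theorem outRowsU_bounds (ε : ℚ) (w : Fin (1 + 1 + 1) → ℝ) (hw : ∀ k, 0 < affF 1 1 (outRowsU ε k) w) :
    0 < w 0 ∧ 0 < w 1 ∧ w 1 < 1 ∧ w 0 < ε * w 1 := by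
  have h0 := hw 0
  have h1 := hw 1
  have h2 := hw 2
  have h3 := hw 3
  simp only [outRowsU, affF_two, Matrix.cons_val_zero, Matrix.cons_val_one, Matrix.cons_val,
    Rat.cast_one, one_mul, Rat.cast_zero, zero_mul, add_zero, zero_add, Rat.cast_neg, neg_mul] at h0 h1 h2 h3
  exact ⟨h0, h1, by linarith, by linarith⟩

/-- The sector rows give `x > 0`, `y > 0`. -/
theorem boxRowsU_pos (ε : ℚ) (z : Fin (1 + 1 + 1) → ℝ) (hz : ∀ k, 0 < affF 1 1 (boxRowsU ε k) z) :
    0 < z 0 ∧ 0 < z 1 := by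
  have h0 := hz 0
  have h1 := hz 1
  simp only [boxRowsU, affF_two, Matrix.cons_val_zero, Matrix.cons_val_one, Rat.cast_one, one_mul,
    Rat.cast_zero, zero_mul, add_zero, zero_add] at h0 h1
  exact ⟨h0, h1⟩

/-- **The blow-up of a corner, steep chart** (rule 2 with `x = ρ`, `y = ρ/ξ`, `t = ρ θ/ξ`,
Jacobian `ρ²/ξ³`). See the module docstring. The rows `M` must pass through the origin unless
they are `y`-free (`hM`), the bounds pass through the origin (`hu`, `hv`); the literal integrand
text is unchanged and the new bounds `chartFU u`, `chartFU v` are `ρ`-free. -/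
theorem cornerBlowUpSteep (ε : ℚ) (s : KZ.IntegralRep (1 + 1 + 1)) (M : Fin m' → (Fin (1 + 1) → ℚ) × ℚ)
    (L : Fin m → (Fin 1 → ℚ) × ℚ) (e : Fin m → ℕ) (p : MvPolynomial (Fin 1) ℚ) (ℓ₁ : (Fin 1 → ℚ) × ℚ)
    (u v : (Fin (1 + 1) → ℚ) × ℚ)
    (hdom : s.domain = gDom 1 1 (m' + 4) (Fin.append M (boxRowsU ε)) (fun _ => Sum.inr u)
      (fun _ => Sum.inr v))
    (hint : EqOn s.integrand (glit 1 1 p L e ℓ₁ 0 0 1 (fun _ => some 0)) s.domain)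
    (hM : ∀ j, (M j).1 1 ≠ 0 → (M j).2 = 0) (hu : u.2 = 0) (hv : v.2 = 0) :
    ∃ s' : KZ.IntegralRep (1 + 1 + 1), Bornology.IsBounded s'.domain ∧
      s'.domain = gDom 1 1 (m' + 4) (Fin.append (fun j => chartRowU (M j)) (outRowsU ε))
        (fun _ => Sum.inr (chartFU u)) (fun _ => Sum.inr (chartFU v)) ∧
      s'.integrand = glit 1 1 p L e ℓ₁ 0 0 1 (fun _ => some 0) ∧
      (∀ w, w ∈ s'.domain ↔ blowU w ∈ s.domain) ∧
      KZ.of s - KZ.of s' ∈ KZ.relations := by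
  set R := gDom 1 1 (m' + 4) (Fin.append (fun j => chartRowU (M j)) (outRowsU ε))
    (fun _ => Sum.inr (chartFU u)) (fun _ => Sum.inr (chartFU v)) with hR
  have ht : ∀ w : Fin (1 + 1 + 1) → ℝ, w 0 * w 2 / w 1 = w 0 / w 1 * w 2 := fun w =>
    mul_div_right_comm _ _ _
  -- membership
  have hΨdom : ∀ w, w ∈ R ↔ blowU w ∈ s.domain := fun w => by
    rw [hR, mem_gDom_append, hdom, mem_gDom_append, boxRowsU_iff]
    constructor
    · rintro ⟨⟨hrow, hbox⟩, hlo, hhi⟩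
      obtain ⟨hρ, hξ, -, -⟩ := outRowsU_bounds ε w hbox
      have hq : 0 < w 0 / w 1 := div_pos hρ hξ
      refine ⟨⟨fun j => (affF_blowU_pos_iff (M j) (hM j) w hρ hξ).2 (hrow j), hbox⟩, ?_, ?_⟩
      · rw [affF_blowU_eq u hu w hξ.ne', blowU_two, ht]
        exact mul_lt_mul_of_pos_left hlo hq
      · rw [affF_blowU_eq v hv w hξ.ne', blowU_two, ht]
        exact mul_lt_mul_of_pos_left hhi hq
    · rintro ⟨⟨hrow, hbox⟩, hlo, hhi⟩
      obtain ⟨hρ, hξ, -, -⟩ := outRowsU_bounds ε w hbox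
      have hq : 0 < w 0 / w 1 := div_pos hρ hξ
      refine ⟨⟨fun j => (affF_blowU_pos_iff (M j) (hM j) w hρ hξ).1 (hrow j), hbox⟩, ?_, ?_⟩
      · rw [affF_blowU_eq u hu w hξ.ne', blowU_two, ht] at hlo
        exact lt_of_mul_lt_mul_left hlo hq.le
      · rw [affF_blowU_eq v hv w hξ.ne', blowU_two, ht] at hhi
        exact lt_of_mul_lt_mul_left hhi hq.le
  have hbR : ∀ w ∈ R, 0 < w 0 ∧ 0 < w 1 ∧ w 1 < 1 ∧ w 0 < ε * w 1 := fun w hw => by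
    rw [hR, mem_gDom_append] at hw
    exact outRowsU_bounds ε w hw.1.2
  have hxD : ∀ z ∈ s.domain, 0 < z 0 ∧ 0 < z 1 := fun z hz => by
    rw [hdom, mem_gDom_append] at hz
    exact boxRowsU_pos ε z hz.1.2
  have himg : blowU '' R = s.domain := by
    ext z
    constructor
    · rintro ⟨w, hw, rfl⟩
      exact (hΨdom w).1 hw
    · intro hz
      obtain ⟨h0, h1⟩ := hxD z hz
      exact ⟨blowUInv z, (hΨdom _).2 (by rw [blowU_blowUInv z h0.ne' h1.ne']; exact hz),
        blowU_blowUInv z h0.ne' h1.ne'⟩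
  have hinj : InjOn blowU R := fun w hw w' hw' h => by
    rw [← blowUInv_blowU w (hbR w hw).1.ne' (hbR w hw).2.1.ne', h,
      blowUInv_blowU w' (hbR w' hw').1.ne' (hbR w' hw').2.1.ne']
  -- the integrand identity
  have hf : ∀ w ∈ R, glit 1 1 p L e ℓ₁ 0 0 1 (fun _ => some 0) w =
      s.integrand (blowU w) * |(blowULin w).det| := by
    intro w hw
    obtain ⟨hρ, hξ, -, -⟩ := hbR w hw
    have hρ0 : w 0 ≠ 0 := hρ.ne'
    have hξ0 : w 1 ≠ 0 := hξ.ne'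
    have h0 : affB 1 1 (0 : (Fin 1 → ℚ) × ℚ) w = 0 := by simp [affB_two]
    rw [hint ((hΨdom w).1 hw), blowULin_det, abs_neg,
      abs_of_pos (div_pos (mul_pos hρ hρ) (pow_pos hξ 3)), glit_two, glit_two]
    simp only [affB_blowU, blowU_zero, blowU_one, blowU_two, h0, sub_zero]
    rcases eq_or_ne (w 2) 0 with h2 | h2
    · rw [h2]
      simp
    · field_simp
  have hRsa : IsSemialgebraic ℚ R := isSemialgebraic_gDom _ _ _ _
  obtain ⟨s', hd', hi', hrel⟩ := cov_glit s _ _ _ p L e ℓ₁ 0 0 1 blowU blowULin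
    (isSemialgebraicMapOn_blowU hRsa) (fun w hw => hasFDerivAt_blowU w (hbR w hw).2.1.ne') hinj himg hf
  refine ⟨s', ?_, hd', hi', fun w => by rw [hd']; exact hΨdom w, hrel⟩
  rw [hd']
  refine isBounded_gDom_of_base _ _ _ (max (ε : ℝ) 1) fun w hw => ?_
  rw [Fin.forall_fin_add] at hw
  simp only [Fin.append_right] at hw
  obtain ⟨hρ, hξ, hξ1, hρε⟩ := outRowsU_bounds ε w hw.2
  have hε : (0 : ℝ) < ε := pos_of_mul_pos_left (hρ.trans hρε) hξ.le
  refine ⟨?_, by rw [abs_of_pos hξ]; exact hξ1.le.trans (le_max_right _ _)⟩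
  rw [abs_of_pos hρ]
  refine le_trans ?_ (le_max_left _ _)
  nlinarith

end SteepMove

end RebasePos

/-- **Registered part of `stub_rebaseSimplePosOneZero` (line `janus-bands`): the blow-up of a
corner, steep chart** (`RebasePos.cornerBlowUpSteep`, rule 2 with `x = ρ`, `y = ρ/ξ`,
`t = ρ θ/ξ`, Jacobian `ρ²/ξ³`): the literal one-fibre datum over the steep sector piece
`{rows, 0 < x < y < ε, u < t < v}` at a corner at the origin (base pole `y = 0`, letter `0`,
rows and bounds through the origin) is congruent modulo `KZ.relations` to the literal datum
`[{rows', ρ > 0, 0 < ξ < 1, ρ < ε ξ, U(ξ) < θ < V(ξ)}, R(ρ)/ξ · 1/θ]` with `ρ`-free bounds. -/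
theorem rebaseSimplePos_cornerBlowUpSteep (m m' : ℕ) (ε : ℚ) (s : KZ.IntegralRep (1 + 1 + 1)) (M : Fin m' → (Fin (1 + 1) → ℚ) × ℚ) (L : Fin m → (Fin 1 → ℚ) × ℚ) (e : Fin m → ℕ) (p : MvPolynomial (Fin 1) ℚ) (ℓ₁ : (Fin 1 → ℚ) × ℚ) (u v : (Fin (1 + 1) → ℚ) × ℚ) (hdom : s.domain = SeparatePos.gDom 1 1 (m' + 4) (Fin.append M (RebasePos.boxRowsU ε)) (fun _ => Sum.inr u) (fun _ => Sum.inr v)) (hint : EqOn s.integrand (RebasePos.glit 1 1 p L e ℓ₁ 0 0 1 (fun _ => some 0)) s.domain) (hM : ∀ j, (M j).1 1 ≠ 0 → (M j).2 = 0) (hu : u.2 = 0) (hv : v.2 = 0) : ∃ s' : KZ.IntegralRep (1 + 1 + 1), Bornology.IsBounded s'.domain ∧ s'.domain = SeparatePos.gDom 1 1 (m' + 4) (Fin.append (fun j => RebasePos.chartRowU (M j)) (RebasePos.outRowsU ε)) (fun _ => Sum.inr (RebasePos.chartFU u)) (fun _ => Sum.inr (RebasePos.chartFU v)) ∧ s'.integrand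 = RebasePos.glit 1 1 p L e ℓ₁ 0 0 1 (fun _ => some 0) ∧ (∀ w, w ∈ s'.domain ↔ RebasePos.blowU w ∈ s.domain) ∧ KZ.of s - KZ.of s' ∈ KZ.relations :=
  RebasePos.cornerBlowUpSteep ε s M L e p ℓ₁ u v hdom hint hM hu hv

end Summit.KontsevichZagierPeriods.ArrangementNormalForm.JanusBands
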